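import Mathlib
import HarnessLib
import Summits.Ventures.LatticeQCDFlow.Exactness.KernelCouplingMask
import Summits.Ventures.LatticeQCDFlow.Exactness.CircularRQSJacobian
import Summits.Ventures.LatticeQCDFlow.Exactness.CircleGroupJacobian

/-!
# The engine's `U(1)` circular-spline PLAQUETTE coupling layer on the lattice is exact: every `L`, every mask with frozen staples, every bin count, parameters from any measurable conditioner

HONEST FRAMING: exact (Metropolis-corrected) sampling algorithms for lattice gauge theory;
figures of merit are autocorrelation/cost numbers at stated couplings and volumes; no
continuum-physics claim.

Venture `LatticeQCDFlow` (cell pub-lqcd), topic `Exactness`; FANOUT row 10 (`eng-equiv`, engine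
`latflow.equiv`, module `equiv/u1.py` "Kanwar NCP/spline plaquette couplings": the active link
`(x, μ)` is multiplied by `h(P) P⁻¹` where `P` is its active plaquette and `h` the circular
rational-quadratic spline `rqs_forward ∘ rqs_normalise(circular=True)` of `equiv/splines.py` whose
`K` widths / heights / slopes and the two shifts are produced by the conditioner from FROZEN links;
the layer books `log dydx` at the plaquette angle; the same layer in `latflow.flows_jax.layers`).
NEW WORK of the cell — the first item of row 10's charter END TO END, assembled from three tree
files: `CircularRQSJacobian.hasJacobian_circle_circRQS` (one circular spline on `ℝ/2πℤ` with
`volume` is exact with the booked derivative; until now used by no other file),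
`KernelCouplingMask.hasJacobian_plaquetteKernelLayer` (a plaquette kernel layer with frozen
staples is `Theory2.coupleFun` and is exact with the kernels' densities at the loops) and row 14's
`CircleGroupJacobian` (the dictionary `ℝ/2πℤ ≃ᵐ U(1) = Circle`, `volume ↦ 2π · haarProbability`).
Nothing is cited as a fact; no number; no definition is introduced.  Printed counterparts, NAMED
ONLY: Kanwar et al., PRL 125 (2020) 121601 (gauge-equivariant `U(1)` flows: plaquette coupling
layers with spline kernels, Fig. 1 masking pattern); Durkan et al. 2019 (rational-quadratic
splines); Rezende et al. 2020 (circular splines).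

## Content

* `hasJacobian_circleGroup_of_addCircle` — transport of a `HasJacobian` certificate for a map of
  `U(1) = Circle` from the conjugate map on `ℝ/2πℤ` with `volume` to `haarProbability Circle`
  (`Theory2.hasJacobian_conj` + `HasJacobian.smul`; the pattern of row 14's
  `hasJacobian_circleGroup_of_degreeOne`, stated once for ANY certificate on the additive circle);
* **`hasJacobian_circleGroup_circRQS`** — ONE LINK / ONE LOOP: the engine's circular
  rational-quadratic spline kernel `e^{iθ} ↦ e^{i(2π·g(fract((θ + c)/2π)) + c')}` on `U(1)` with the
  booked density `g'(fract((θ + c)/2π))` has `HasJacobian (haarProbability Circle)`, for every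
  `K ≥ 1` and all admissible widths / heights / slopes (`d K = d 0`);
* `measurable_circRQSKernel_prod`, `measurable_circRQSDensity_prod`, `circRQSDensity_nonneg` —
  joint measurability in (loop, frozen links) of the kernel and of its density when the profile
  `g`, the booked derivative `g'` and the shifts are jointly measurable in (frozen links, argument),
  and nonnegativity of the density;
* **`hasJacobian_u1SplinePlaquetteCouplingLayer`** — THE LAYER on `GaugeConfig d L Circle` with the
  product of normalised Haar measures: for ANY mask `p` and plane choice `ν` under which the three
  staple links of every active plaquette are frozen, spline data read from the frozen links
  (widths, heights, slopes, knots, shifts; profile and derivative agreeing with the bin closed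
  forms, jointly measurable), the layer
  `V(x,μ) ↦ h_{x,μ}(P) P⁻¹ V(x,μ)` (active), `V e ↦ V e` (frozen) has
  `HasJacobian (⊗ Haar_{U(1)}) layer (ofReal ∘ Theory2.coupleJac p j)` with `j` = the booked spline
  derivative at the plaquette angle — the exactness hypothesis of the cell's flow theorems;
* `wilsonWeight_eq_reweight_u1SplinePlaquetteCouplingLayer` — E3 (`wilson_flow_reweighting_exact`)
  for this layer with its `HasJacobian` hypothesis discharged: prior `(q ∘ layer)·coupleJac` pushed
  through the layer and reweighted by `e^{−βS_W}/q` IS `wilsonWeight ρ β`;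
* **`hasJacobian_u1SplinePlaquetteCouplingLayer_directionMask`** — the engine's direction masks
  (`p e ↔ e.2 = μ ∧ φ e.1 = a` for an additive phase `φ`, plane `ν e ≠ μ` with `φ(ν̂) ≠ 0`:
  `stripes`, `gen-checker`, for EVERY `L`) meet the frozen-staple hypotheses
  (`directionMask_*_frozen`), so the conclusion holds for them verbatim.

NOT here: the inverse pass; NCP kernels (row 14's `NCPCircleJacobian` / `NCPLayerEquiv` type the
NCP mixtures as link maps; the plaquette version is the same assembly); `SU(N)` (files
`Spectral*`, `SUN*`); any number.
-/

noncomputable section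

namespace Summit.Ventures.LatticeQCDFlow.Exactness

open Real Set Function MeasureTheory Summit.Ventures.LatticeQCDFlow.Theory2
open Literature.MathematicalPhysics.QuantumFieldTheory
open scoped ENNReal

/-! ## Transport `ℝ/2πℤ, volume` ⟶ `U(1), haarProbability` -/

section Transport

/-- **Transport of a one-link certificate to the multiplicative circle.**  If the conjugate of
`F : U(1) → U(1)` under `ℝ/2πℤ ≃ᵐ U(1)` (`↑θ ↦ e^{iθ}`) has `HasJacobian volume` with the pulled-back
density, then `F` has `HasJacobian (haarProbability Circle) F J`. -/
theorem hasJacobian_circleGroup_of_addCircle {F : Circle → Circle} {J : Circle → ℝ≥0∞}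
    (hA : HasJacobian (volume : Measure (AddCircle (2 * π)))
      (fun x => (Homeomorph.toMeasurableEquiv AddCircle.homeomorphCircle' :
        AddCircle (2 * π) ≃ᵐ Circle).symm
        (F ((Homeomorph.toMeasurableEquiv AddCircle.homeomorphCircle' :
          AddCircle (2 * π) ≃ᵐ Circle) x)))
      (fun x => J ((Homeomorph.toMeasurableEquiv AddCircle.homeomorphCircle' :
        AddCircle (2 * π) ≃ᵐ Circle) x))) :
    HasJacobian (haarProbability Circle) F J := by
  have hC := hasJacobian_conj
    (Homeomorph.toMeasurableEquiv AddCircle.homeomorphCircle' : AddCircle (2 * π) ≃ᵐ Circle).symm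
    map_circleEquiv_symm_smul_haar hA
  have hC' : HasJacobian (ENNReal.ofReal (2 * π) • haarProbability Circle) F J := by
    convert hC using 1
    · funext z
      simp only [Function.comp_apply, MeasurableEquiv.symm_symm, MeasurableEquiv.apply_symm_apply]
    · funext z
      simp only [Function.comp_apply, MeasurableEquiv.apply_symm_apply]
  have hs := hC'.smul (ENNReal.ofReal (2 * π))⁻¹
  rwa [smul_smul, ENNReal.inv_mul_cancel ((ENNReal.ofReal_pos.mpr Real.two_pi_pos).ne')
    ENNReal.ofReal_ne_top, one_smul] at hs

end Transport

/-! ## One link / one loop: the circular rational-quadratic spline kernel on `U(1)` -/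

section OneLink

variable {K : ℕ} {w h d X Y : ℕ → ℝ} {g g' : ℝ → ℝ}

/-- **The engine's circular rational-quadratic spline kernel on a `U(1)` loop is exact for the
normalised Haar measure.**  `K ≥ 1` bins, widths / heights / slopes positive, knots
`X 0 = 0, X (k+1) = X k + w k, X K = 1`, `Y 0 = 0, Y (k+1) = Y k + h k, Y K = 1`, circular slopes
`d K = d 0`; `g`, `g'` agree on every closed bin with the bin's closed form and the booked `dydx`
(`CircularRQSJacobian`).  Then for all shifts `c, c'` and any `F : U(1) → U(1)`, `J` with
`F(e^{iθ}) = e^{i(2π·g(fract((θ + c)/(2π))) + c')}`, `J(e^{iθ}) = ofReal (g'(fract((θ + c)/(2π))))`: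
`HasJacobian (haarProbability Circle) F J`. -/
theorem hasJacobian_circleGroup_circRQS (hK : 0 < K)
    (hw : ∀ k < K, 0 < w k) (hh : ∀ k < K, 0 < h k) (hd : ∀ k ≤ K, 0 < d k) (hcirc : d K = d 0)
    (hX0 : X 0 = 0) (hXs : ∀ k < K, X (k + 1) = X k + w k) (hXK : X K = 1)
    (hY0 : Y 0 = 0) (hYs : ∀ k < K, Y (k + 1) = Y k + h k) (hYK : Y K = 1)
    (hg : ∀ k < K, ∀ x ∈ Icc (X k) (X (k + 1)), g x = Y k + h k * ((h k / w k * ((x - X k) / w k) ^ 2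
      + d k * ((x - X k) / w k * (1 - (x - X k) / w k))) /
      (h k / w k + (d (k + 1) + d k - 2 * (h k / w k)) * ((x - X k) / w k * (1 - (x - X k) / w k)))))
    (hg' : ∀ k < K, ∀ x ∈ Icc (X k) (X (k + 1)), g' x = h k / w k * (h k / w k *
      (d (k + 1) * ((x - X k) / w k) ^ 2 + 2 * (h k / w k) * ((x - X k) / w k * (1 - (x - X k) / w k))
      + d k * (1 - (x - X k) / w k) ^ 2) /
      (h k / w k + (d (k + 1) + d k - 2 * (h k / w k)) * ((x - X k) / w k * (1 - (x - X k) / w k))) ^ 2))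
    (c c' : ℝ) {F : Circle → Circle}
    (hF : ∀ θ : ℝ, F (Circle.exp θ) = Circle.exp (2 * π * g (Int.fract ((θ + c) / (2 * π))) + c'))
    {J : Circle → ℝ≥0∞}
    (hJ : ∀ θ : ℝ, J (Circle.exp θ) = ENNReal.ofReal (g' (Int.fract ((θ + c) / (2 * π))))) :
    HasJacobian (haarProbability Circle) F J := by
  refine hasJacobian_circleGroup_of_addCircle ?_
  refine hasJacobian_circle_circRQS hK hw hh hd hcirc hX0 hXs hXK hY0 hYs hYK hg hg' c c'
    (fun θ => ?_) (fun θ => ?_)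
  · rw [coe_circleEquiv_apply_coe, hF, ← coe_circleEquiv_apply_coe, MeasurableEquiv.symm_apply_apply]
  · rw [coe_circleEquiv_apply_coe, hJ]

/-- The booked density of the circular spline kernel is nonnegative on the whole loop group
(`fract ∈ [0,1) ⊆ [X 0, X K]`, `circRQS_deriv_pos`). -/
theorem circRQSDensity_nonneg (hK : 0 < K)
    (hw : ∀ k < K, 0 < w k) (hh : ∀ k < K, 0 < h k) (hd : ∀ k ≤ K, 0 < d k)
    (hX0 : X 0 = 0) (hXs : ∀ k < K, X (k + 1) = X k + w k) (hXK : X K = 1)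
    (hg' : ∀ k < K, ∀ x ∈ Icc (X k) (X (k + 1)), g' x = h k / w k * (h k / w k *
      (d (k + 1) * ((x - X k) / w k) ^ 2 + 2 * (h k / w k) * ((x - X k) / w k * (1 - (x - X k) / w k))
      + d k * (1 - (x - X k) / w k) ^ 2) /
      (h k / w k + (d (k + 1) + d k - 2 * (h k / w k)) * ((x - X k) / w k * (1 - (x - X k) / w k))) ^ 2))
    (c : ℝ) {j : Circle → ℝ}
    (hj : ∀ θ : ℝ, j (Circle.exp θ) = g' (Int.fract ((θ + c) / (2 * π)))) (z : Circle) :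
    0 ≤ j z := by
  obtain ⟨θ, rfl⟩ := Circle.exp_surjective z
  rw [hj]
  refine (circRQS_deriv_pos hK hw hh hd hXs hg' ?_).le
  rw [hX0, hXK]
  exact ⟨Int.fract_nonneg _, (Int.fract_lt_one _).le⟩

end OneLink

/-! ## Joint measurability in (loop, frozen links) -/

section Measurable

variable {Yf : Type*} [MeasurableSpace Yf]

/-- The spline kernel with profile and shifts read from a parameter (the frozen links) is jointly
measurable in (loop, parameter) as soon as `(y, x) ↦ g y x` and the shifts are measurable. -/
theorem measurable_circRQSKernel_prod {g : Yf → ℝ → ℝ} {c c' : Yf → ℝ}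
    (hgm : Measurable fun q : Yf × ℝ => g q.1 q.2) (hc : Measurable c) (hc' : Measurable c')
    {H : Yf → Circle → Circle}
    (hH : ∀ y (θ : ℝ), H y (Circle.exp θ) =
      Circle.exp (2 * π * g y (Int.fract ((θ + c y) / (2 * π))) + c' y)) :
    Measurable fun q : Circle × Yf => H q.2 q.1 := by
  refine Circle.measurable_of_measurable_comp_exp_prod ?_
  simp_rw [hH]
  refine Circle.exp.continuous.measurable.comp ?_
  refine ((measurable_const.mul (hgm.comp (measurable_snd.prodMk ?_))).add (hc'.comp measurable_snd))
  exact (measurable_fract.comp ((measurable_fst.add (hc.comp measurable_snd)).div_const _))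

/-- The booked density with profile derivative and shift read from a parameter is jointly
measurable in (loop, parameter). -/
theorem measurable_circRQSDensity_prod {g' : Yf → ℝ → ℝ} {c : Yf → ℝ}
    (hg'm : Measurable fun q : Yf × ℝ => g' q.1 q.2) (hc : Measurable c)
    {j : Yf → Circle → ℝ}
    (hj : ∀ y (θ : ℝ), j y (Circle.exp θ) = g' y (Int.fract ((θ + c y) / (2 * π)))) :
    Measurable fun q : Circle × Yf => j q.2 q.1 := by
  refine Circle.measurable_of_measurable_comp_exp_prod ?_
  simp_rw [hj]
  refine hg'm.comp (measurable_snd.prodMk ?_)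
  exact (measurable_fract.comp ((measurable_fst.add (hc.comp measurable_snd)).div_const _))

end Measurable

/-! ## The layer on `GaugeConfig d L Circle` -/

section Layer

variable {d L : ℕ} [NeZero L]
  (p : Edge d L → Prop) [DecidablePred p] (ν : Edge d L → Fin d)
  (h1 : ∀ e, p e → ¬p (e.1.shift e.2, ν e)) (h2 : ∀ e, p e → ¬p (e.1.shift (ν e), e.2))
  (h3 : ∀ e, p e → ¬p (e.1, ν e))
  {K : ℕ} (hK : 0 < K)
  {w hgt dsl X Y : Edge d L → ({f : Edge d L // ¬p f} → Circle) → ℕ → ℝ}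
  (hw : ∀ e y, ∀ k < K, 0 < w e y k) (hh : ∀ e y, ∀ k < K, 0 < hgt e y k)
  (hd : ∀ e y, ∀ k ≤ K, 0 < dsl e y k) (hcirc : ∀ e y, dsl e y K = dsl e y 0)
  (hX0 : ∀ e y, X e y 0 = 0) (hXs : ∀ e y, ∀ k < K, X e y (k + 1) = X e y k + w e y k)
  (hXK : ∀ e y, X e y K = 1)
  (hY0 : ∀ e y, Y e y 0 = 0) (hYs : ∀ e y, ∀ k < K, Y e y (k + 1) = Y e y k + hgt e y k)
  (hYK : ∀ e y, Y e y K = 1)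
  {c c' : Edge d L → ({f : Edge d L // ¬p f} → Circle) → ℝ}
  (hc : ∀ e, Measurable (c e)) (hc' : ∀ e, Measurable (c' e))
  {g g' : Edge d L → ({f : Edge d L // ¬p f} → Circle) → ℝ → ℝ}
  (hgm : ∀ e, Measurable fun q : ({f : Edge d L // ¬p f} → Circle) × ℝ => g e q.1 q.2)
  (hg'm : ∀ e, Measurable fun q : ({f : Edge d L // ¬p f} → Circle) × ℝ => g' e q.1 q.2)
  (hg : ∀ e y, ∀ k < K, ∀ x ∈ Icc (X e y k) (X e y (k + 1)), g e y x = Y e y k + hgt e y k *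
      ((hgt e y k / w e y k * ((x - X e y k) / w e y k) ^ 2
      + dsl e y k * ((x - X e y k) / w e y k * (1 - (x - X e y k) / w e y k))) /
      (hgt e y k / w e y k + (dsl e y (k + 1) + dsl e y k - 2 * (hgt e y k / w e y k)) *
        ((x - X e y k) / w e y k * (1 - (x - X e y k) / w e y k)))))
  (hg' : ∀ e y, ∀ k < K, ∀ x ∈ Icc (X e y k) (X e y (k + 1)), g' e y x = hgt e y k / w e y k *
      (hgt e y k / w e y k *
      (dsl e y (k + 1) * ((x - X e y k) / w e y k) ^ 2 + 2 * (hgt e y k / w e y k) *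
        ((x - X e y k) / w e y k * (1 - (x - X e y k) / w e y k))
      + dsl e y k * (1 - (x - X e y k) / w e y k) ^ 2) /
      (hgt e y k / w e y k + (dsl e y (k + 1) + dsl e y k - 2 * (hgt e y k / w e y k)) *
        ((x - X e y k) / w e y k * (1 - (x - X e y k) / w e y k))) ^ 2))
  (hol : GaugeConfig d L Circle → Edge d L → Circle → Circle)
  (H : Edge d L → ({f : Edge d L // ¬p f} → Circle) → Circle → Circle)
  (hHV : ∀ (V : GaugeConfig d L Circle) (e : Edge d L), p e → hol V e = H e (fun f => V f))
  (hH : ∀ e y (θ : ℝ), H e y (Circle.exp θ) =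
    Circle.exp (2 * π * g e y (Int.fract ((θ + c e y) / (2 * π))) + c' e y))
  (j : Edge d L → ({f : Edge d L // ¬p f} → Circle) → Circle → ℝ)
  (hj : ∀ e y (θ : ℝ), j e y (Circle.exp θ) = g' e y (Int.fract ((θ + c e y) / (2 * π))))

include hK hw hh hd hcirc hX0 hXs hXK hY0 hYs hYK hc hc' hgm hg'm hg hg' hHV hH hj in
/-- **The engine's `U(1)` circular-spline plaquette coupling layer is exact.**  Lattice
`(ℤ/L)^d`, link group `U(1) = Circle`, reference measure `⊗_links haarProbability Circle`.  Mask `p`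
and plane choice `ν` such that at every active link `e = (x, μ)` the three staple links
`(x+μ̂, ν e)`, `(x+ν̂ e, μ)`, `(x, ν e)` of its active plaquette are frozen (`h1`–`h3`).  Spline data
per active link read from the FROZEN links `y`: `K ≥ 1` bins, widths `w e y k`, heights
`hgt e y k`, slopes `dsl e y k` (positive, circular `dsl e y K = dsl e y 0`), knots `X e y`,
`Y e y` (cumulative, from `0` to `1`), shifts `c e y`, `c' e y` (measurable); profile `g e y` and
booked derivative `g' e y` agreeing with the bin closed forms, jointly measurable in `(y, x)`.
Kernel field `hol V e` reading frozen links only (`hol V e = H e (V|frozen)`), with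
`H e y (e^{iθ}) = e^{i(2π·g e y(fract((θ + c e y)/2π)) + c' e y)}`, booked density
`j e y (e^{iθ}) = g' e y (fract((θ + c e y)/2π))`.  Then the layer
`V e ↦ hol V e (P) P⁻¹ V e` on active links (`P` the active plaquette), identity on frozen links,
has `HasJacobian (⊗ Haar) layer (ofReal ∘ Theory2.coupleJac p (j at the plaquettes))`. -/
theorem hasJacobian_u1SplinePlaquetteCouplingLayer :
    HasJacobian (MeasureTheory.Measure.pi fun _ : Edge d L => haarProbability Circle)
      (fun (V : GaugeConfig d L Circle) (e : Edge d L) =>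
        if p e then hol V e (plaquetteHolonomy V e.1 e.2 (ν e)) *
          (plaquetteHolonomy V e.1 e.2 (ν e))⁻¹ * V e
        else V e)
      fun V => ENNReal.ofReal (Theory2.coupleJac p (fun a y u =>
        j a.1 y (u * (y ⟨_, h1 a.1 a.2⟩ * (y ⟨_, h2 a.1 a.2⟩)⁻¹ * (y ⟨_, h3 a.1 a.2⟩)⁻¹))) V) := by
  -- joint measurability of kernel and density in (loop, frozen links)
  have hHm : ∀ e, Measurable fun q : Circle × ({f : Edge d L // ¬p f} → Circle) => H e q.2 q.1 :=
    fun e => measurable_circRQSKernel_prod (hgm e) (hc e) (hc' e) (hH e)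
  have hjm : ∀ e, Measurable fun q : Circle × ({f : Edge d L // ¬p f} → Circle) => j e q.2 q.1 :=
    fun e => measurable_circRQSDensity_prod (hg'm e) (hc e) (hj e)
  -- the staple as a measurable function of the frozen links, and the loop `u · S`
  have hev : ∀ f₀ : {f : Edge d L // ¬p f}, Measurable fun y : ({f : Edge d L // ¬p f} → Circle) => y f₀ :=
    fun f₀ => measurable_pi_apply f₀
  have hS : ∀ a : {e // p e}, Measurable fun y : ({f : Edge d L // ¬p f} → Circle) =>
      y ⟨_, h1 a.1 a.2⟩ * (y ⟨_, h2 a.1 a.2⟩)⁻¹ * (y ⟨_, h3 a.1 a.2⟩)⁻¹ := fun a =>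
    ((hev _).mul (hev _).inv).mul (hev _).inv
  have hloop : ∀ a : {e // p e}, Measurable fun q : Circle × ({f : Edge d L // ¬p f} → Circle) =>
      q.1 * (q.2 ⟨_, h1 a.1 a.2⟩ * (q.2 ⟨_, h2 a.1 a.2⟩)⁻¹ * (q.2 ⟨_, h3 a.1 a.2⟩)⁻¹) := fun a =>
    measurable_fst.mul ((hS a).comp measurable_snd)
  refine hasJacobian_plaquetteKernelLayer p ν hol H j hHV h1 h2 h3 (fun a => ?_) (fun a => ?_)
    (fun a y => ?_) (fun a y z => ?_)
  · exact (((hHm a.1).comp ((hloop a).prodMk measurable_snd)).mul (hloop a).inv).mul measurable_fst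
  · exact (hjm a.1).comp ((hloop a).prodMk measurable_snd)
  · exact hasJacobian_circleGroup_circRQS hK (hw a.1 y) (hh a.1 y) (hd a.1 y) (hcirc a.1 y)
      (hX0 a.1 y) (hXs a.1 y) (hXK a.1 y) (hY0 a.1 y) (hYs a.1 y) (hYK a.1 y) (hg a.1 y) (hg' a.1 y)
      (c a.1 y) (c' a.1 y) (hH a.1 y) (fun θ => by simp only [hj])
  · exact circRQSDensity_nonneg hK (hw a.1 y) (hh a.1 y) (hd a.1 y) (hX0 a.1 y) (hXs a.1 y)
      (hXK a.1 y) (hg' a.1 y) (c a.1 y) (hj a.1 y) z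

include hK hw hh hd hcirc hX0 hXs hXK hY0 hYs hYK hc hc' hgm hg'm hg hg' hHV hH hj in
/-- **E3 for the engine's `U(1)` spline plaquette coupling layer** (`FlowPushforward.wilson_flow_reweighting_exact`
with its `HasJacobian` hypothesis DISCHARGED by `hasJacobian_u1SplinePlaquetteCouplingLayer`): pushing the
prior of density `(q ∘ layer) · coupleJac` through the layer and reweighting by `e^{−β S_W}/q` gives
exactly the tree's un-normalised Wilson weight `wilsonWeight ρ β`, for any representation `ρ` of
`U(1)` with measurable Wilson action and any positive finite measurable model density `q`.  (A
flow of several layers composes by `HasJacobian.comp`.) -/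
theorem wilsonWeight_eq_reweight_u1SplinePlaquetteCouplingLayer {N : ℕ}
    (ρ : Circle →* Matrix (Fin N) (Fin N) ℂ) (β : ℝ)
    (hSW : Measurable (wilsonAction (d := d) (L := L) ρ))
    {q : GaugeConfig d L Circle → ℝ≥0∞} (hq : Measurable q) (hq0 : ∀ U, q U ≠ 0) (hqtop : ∀ U, q U ≠ ∞) :
    (MeasureTheory.Measure.map
        (fun (V : GaugeConfig d L Circle) (e : Edge d L) =>
          if p e then hol V e (plaquetteHolonomy V e.1 e.2 (ν e)) *
            (plaquetteHolonomy V e.1 e.2 (ν e))⁻¹ * V e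
          else V e)
        ((MeasureTheory.Measure.pi fun _ : Edge d L => haarProbability Circle).withDensity fun V =>
          q (fun e : Edge d L =>
              if p e then hol V e (plaquetteHolonomy V e.1 e.2 (ν e)) *
                (plaquetteHolonomy V e.1 e.2 (ν e))⁻¹ * V e
              else V e) *
            ENNReal.ofReal (Theory2.coupleJac p (fun a y u =>
              j a.1 y (u * (y ⟨_, h1 a.1 a.2⟩ * (y ⟨_, h2 a.1 a.2⟩)⁻¹ * (y ⟨_, h3 a.1 a.2⟩)⁻¹))) V))).withDensity
        (fun U => ENNReal.ofReal (Real.exp (-β * wilsonAction ρ U)) / q U) =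
      wilsonWeight ρ β :=
  wilson_flow_reweighting_exact ρ β
    (hasJacobian_u1SplinePlaquetteCouplingLayer p ν h1 h2 h3 hK hw hh hd hcirc hX0 hXs hXK hY0 hYs hYK hc hc'
      hgm hg'm hg hg' hol H hHV hH j hj) hSW hq hq0 hqtop

end Layer

/-! ## The engine's direction masks -/

section DirectionMask

variable {d L : ℕ} [NeZero L] {A : Type*} [AddGroup A] [DecidableEq A]
  (φ : (Fin d → ZMod L) →+ A) (a : A) (μ : Fin d) (ν : Edge d L → Fin d)
  (hν : ∀ e, ν e ≠ e.2) (hφ : ∀ e, φ (Pi.single (ν e) 1) ≠ 0)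
  {K : ℕ} (hK : 0 < K)
  {w hgt dsl X Y : Edge d L → ({f : Edge d L // ¬(f.2 = μ ∧ φ f.1 = a)} → Circle) → ℕ → ℝ}
  (hw : ∀ e y, ∀ k < K, 0 < w e y k) (hh : ∀ e y, ∀ k < K, 0 < hgt e y k)
  (hd : ∀ e y, ∀ k ≤ K, 0 < dsl e y k) (hcirc : ∀ e y, dsl e y K = dsl e y 0)
  (hX0 : ∀ e y, X e y 0 = 0) (hXs : ∀ e y, ∀ k < K, X e y (k + 1) = X e y k + w e y k)
  (hXK : ∀ e y, X e y K = 1)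
  (hY0 : ∀ e y, Y e y 0 = 0) (hYs : ∀ e y, ∀ k < K, Y e y (k + 1) = Y e y k + hgt e y k)
  (hYK : ∀ e y, Y e y K = 1)
  {c c' : Edge d L → ({f : Edge d L // ¬(f.2 = μ ∧ φ f.1 = a)} → Circle) → ℝ}
  (hc : ∀ e, Measurable (c e)) (hc' : ∀ e, Measurable (c' e))
  {g g' : Edge d L → ({f : Edge d L // ¬(f.2 = μ ∧ φ f.1 = a)} → Circle) → ℝ → ℝ}
  (hgm : ∀ e, Measurable fun q : ({f : Edge d L // ¬(f.2 = μ ∧ φ f.1 = a)} → Circle) × ℝ => g e q.1 q.2)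
  (hg'm : ∀ e, Measurable fun q : ({f : Edge d L // ¬(f.2 = μ ∧ φ f.1 = a)} → Circle) × ℝ => g' e q.1 q.2)
  (hg : ∀ e y, ∀ k < K, ∀ x ∈ Icc (X e y k) (X e y (k + 1)), g e y x = Y e y k + hgt e y k *
      ((hgt e y k / w e y k * ((x - X e y k) / w e y k) ^ 2
      + dsl e y k * ((x - X e y k) / w e y k * (1 - (x - X e y k) / w e y k))) /
      (hgt e y k / w e y k + (dsl e y (k + 1) + dsl e y k - 2 * (hgt e y k / w e y k)) *
        ((x - X e y k) / w e y k * (1 - (x - X e y k) / w e y k)))))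
  (hg' : ∀ e y, ∀ k < K, ∀ x ∈ Icc (X e y k) (X e y (k + 1)), g' e y x = hgt e y k / w e y k *
      (hgt e y k / w e y k *
      (dsl e y (k + 1) * ((x - X e y k) / w e y k) ^ 2 + 2 * (hgt e y k / w e y k) *
        ((x - X e y k) / w e y k * (1 - (x - X e y k) / w e y k))
      + dsl e y k * (1 - (x - X e y k) / w e y k) ^ 2) /
      (hgt e y k / w e y k + (dsl e y (k + 1) + dsl e y k - 2 * (hgt e y k / w e y k)) *
        ((x - X e y k) / w e y k * (1 - (x - X e y k) / w e y k))) ^ 2))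
  (hol : GaugeConfig d L Circle → Edge d L → Circle → Circle)
  (H : Edge d L → ({f : Edge d L // ¬(f.2 = μ ∧ φ f.1 = a)} → Circle) → Circle → Circle)
  (hHV : ∀ (V : GaugeConfig d L Circle) (e : Edge d L), e.2 = μ ∧ φ e.1 = a → hol V e = H e (fun f => V f))
  (hH : ∀ e y (θ : ℝ), H e y (Circle.exp θ) =
    Circle.exp (2 * π * g e y (Int.fract ((θ + c e y) / (2 * π))) + c' e y))
  (j : Edge d L → ({f : Edge d L // ¬(f.2 = μ ∧ φ f.1 = a)} → Circle) → Circle → ℝ)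
  (hj : ∀ e y (θ : ℝ), j e y (Circle.exp θ) = g' e y (Int.fract ((θ + c e y) / (2 * π))))

include hν hφ hK hw hh hd hcirc hX0 hXs hXK hY0 hYs hYK hc hc' hgm hg'm hg hg' hHV hH hj in
/-- **The same for the engine's direction masks, every lattice size.**  Active links: direction
`μ` at the sites of phase `a` of an additive phase map `φ` (`masks.py` `stripes` / `gen-checker`);
active plaquette in a plane `ν e ≠ μ` along which the phase moves (`φ(ν̂) ≠ 0`).  The three staple
links are then frozen (`KernelCouplingMask.directionMask_*_frozen`) and the `U(1)` circular-spline
plaquette coupling layer is exact for `⊗ Haar_{U(1)}` with the booked density. -/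
theorem hasJacobian_u1SplinePlaquetteCouplingLayer_directionMask :
    HasJacobian (MeasureTheory.Measure.pi fun _ : Edge d L => haarProbability Circle)
      (fun (V : GaugeConfig d L Circle) (e : Edge d L) =>
        if e.2 = μ ∧ φ e.1 = a then hol V e (plaquetteHolonomy V e.1 e.2 (ν e)) *
          (plaquetteHolonomy V e.1 e.2 (ν e))⁻¹ * V e
        else V e)
      fun V => ENNReal.ofReal (Theory2.coupleJac (fun e : Edge d L => e.2 = μ ∧ φ e.1 = a)
        (fun b y u => j b.1 y (u *
          (y ⟨_, directionMask_shift_dir_frozen φ a μ ν hν b.1 b.2⟩ *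
            (y ⟨_, directionMask_shift_plane_frozen φ a μ ν hφ b.1 b.2⟩)⁻¹ *
            (y ⟨_, directionMask_plane_frozen φ a μ ν hν b.1 b.2⟩)⁻¹))) V) :=
  hasJacobian_u1SplinePlaquetteCouplingLayer (fun e : Edge d L => e.2 = μ ∧ φ e.1 = a) ν
    (directionMask_shift_dir_frozen φ a μ ν hν) (directionMask_shift_plane_frozen φ a μ ν hφ)
    (directionMask_plane_frozen φ a μ ν hν) hK hw hh hd hcirc hX0 hXs hXK hY0 hYs hYK hc hc'
    hgm hg'm hg hg' hol H hHV hH j hj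

end DirectionMask

end Summit.Ventures.LatticeQCDFlow.Exactness
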